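import Summits.QuantumFields.YangMills.Theorems.BalabanUVNodesN17D1OfNamedLimit
import Summits.QuantumFields.YangMills.Theorems.BalabanUVNodesN17AtSpineCarriers
import Literature.MathematicalPhysics.QuantumFieldTheory.Balaban1983to89.T4BetaStationary

/-!
# NODE N17 (NE4) — SUPPLIER ROAD TO K2⁷, FILE 4: node U3's END-FREE TRIPLE ((D4) `ReadOutAt`, N18 `N18At`, N22 `N22At`) at the record supplies BOTH node N17 AND survivor continuity,
# so MODULO NODE U3 the registered 2ᴮ″ IS EXACTLY «some κ ANCHORS» and the whole of K2⁷ is «identification ∧ the named limit's VALUE `stepBal 2 F.L`»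

Cell `pub-ymgap`, YM-PLAN Track A (HUMAN RULINGS D-0062 ∕ D-0149), WIDTH SEAT `pub-ymgap-dag-n17-w1` (generation 3), fourth module.  Key K3⁷ stmt-QuantumFields-20544
(`--kind proof --supports 20544 --as helper`, COUNT-NEUTRAL); via node N17 also K2⁷ stmt-QuantumFields-20543 (skeleton v6 5a75a2378c79b303: 1ᴬ `stub_d1AnchoredJets13 : D1AtAnchoredJets`,
2ᴮ″ `stub_runRemNamedJets13 : RunRemAtSomeJets`).  Continues FILES 1–3 (p600401 ∕ p602302 ∕ p603839): there the K2⁷ residue modulo the END-free N17 text was located as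
«identification (DEF-1's `ScaleAnchor` at `θ.cβ • beta0OfJs F κ`) ∧ survivor continuity at one positive level ∧ `beta0OfJs F κ → stepBal 2 F.L`».

THE POINT.  Node U3's triple at a carrier bundle `u` on the datum — (D4) `ReadOutAt D u`, N18 `N18At u`, N22 `N22At u` (tree `YMDAG.UVSplit`, K3⁷'s END-free per-bundle currency; at the
record these are the n17∕n18∕n22 lanes' kernel-objects roads, none keyed on the endpoint) — gives node U2's WHOLE input triple `U2Inputs D (cr·C₅·θ) (cr·C₉·ω) ρ u.γ Λ′` (dag-n17-a
`YMDAG.N17.u2Inputs_of_readOutAt`, over `Spine.NE4.Targets.u2Inputs_of_u3`): NE4 = node N17 (`n17At_of_readOutAt`, from (D4) ∧ N18 alone) AND `HistLipschitz Λ′ u.γ D.βfun`, the history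
moduli of NE9 read out on the β-functions.  A history-Lipschitz family is continuous on the boxes (`T4BetaStationary.betaContH_of_histLipschitz`), and box (C) on `]0, θ.γ]` gives DEF-1's
run-wise (C) `SurvCont` at EVERY level `≤ θ.γ` (FILE 1 `survCont_allLevels_of_betaContH`).  Hence (★★ `runRemAt_of_u3Triple_scaleAnchor`): the U3 triple at `u` with `u.γ = θ.γ`,
`0 ≤ u.ρ < 1` + `ScaleAnchor D.βfun (θ.cβ • beta0OfJs F κ)` ⟹ `RunRemAt F κ θ hP θ.cβ`, and (★★★ `runRemAt_iff_scaleAnchor_of_u3Triple`) GIVEN the U3 triple,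
`RunRemAt F κ θ hP θ.cβ ⟺ ScaleAnchor D.βfun (θ.cβ • beta0OfJs F κ)` — 2ᴮ″'s letter IS the identification clause ALONE.  Text level (K2⁷ v6's full prefix, `Window13` spelled as the crux decl
spells it; the END-free U3-TRIPLE TEXT «∃ u, u.γ = θ.γ ∧ 0 ≤ u.ρ ∧ u.ρ < 1 ∧ ReadOutAt (datum) u ∧ N18At u ∧ N22At u»): ★★★ `runRemAtSomeJets_iff_anchorSomeJets_of_u3TripleAtRecord13` — GIVEN the
U3-triple text, the REGISTERED 2ᴮ″ text ⟺ the text «∃ κ, ScaleAnchor (datum).βfun (θ.cβ • beta0OfJs F κ)» (= refuter CRIT-2 ROUND 2e's BN-F-immune anchor stub `AnchorSomeJets13`, here with v6's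
prefix); ★★★ `EndpointGivenBR13SepCoPH_of_u3TripleAtRecord13_anchorLimit` — the crux decl BY NAME from the U3-triple text + ONE located text «∃ κ, ScaleAnchor … ∧ Tendsto (beta0OfJs F κ) atTop
(𝓝 (stepBal 2 F.L))».  SO, MODULO NODE U3's END-FREE TRIPLE, THE WHOLE OF K2⁷ = identification ∧ the VALUE of the named limit (row (D1) ∕ (AF-0∞)); the (C) letter of 2ᴮ″ is node N22's
(its history moduli), the remainder letter is node N17's (FILES 1–2), the existence of the named limit is N17's + the anchor's (FILE 3).

WHAT THIS FILE PROVES (theorems only; 0 `def`, 0 `instance`, 0 `sorry`): §1 generic `survCont_allLevels_of_histLipschitz`; §2 (N = 2, `datumOfRecord₁₃SepCoPH`) `survCont_allLevels_of_u3Triple`,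
★★ `runRemAt_of_u3Triple_scaleAnchor`, ★★★ `runRemAt_iff_scaleAnchor_of_u3Triple`, `exists_oneLoopDrift_iff_tendsto_stepBal_of_u3Triple_scaleAnchor`; §3 (texts inline) `n17AtRecord13_of_u3TripleAtRecord13`,
★★★ `runRemAtSomeJets_iff_anchorSomeJets_of_u3TripleAtRecord13`, ★★★ `EndpointGivenBR13SepCoPH_of_u3TripleAtRecord13_anchorLimit`.  dag-n17-a's `YMDAG.N17.n17At_of_readOutAt` ∕
`u2Inputs_of_readOutAt`, `T4BetaStationary.betaContH_of_histLipschitz`, DEF-1's letters, FILES 1–3 BY NAME; nothing restated.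

HONEST SCOPE (A6, director-ym №189).  Elementary bookkeeping ∕ real analysis over hypothesis SHAPES; §2–§3 quantify over `θ : Stage13HParams F 2` with `hP : θ.Provisos₁₃SepCoPH F 2` — inhabited iff
K0⁷ (stmt-QuantumFields-20541).  NOTHING of Bałaban is asserted or instantiated: NE5 ∕ NE9 ∕ fading memory ∕ (D4) ∕ NE4 NOT PRINTED for d = 4 beyond [Balaban1987RG1] (1.20)–(1.22)'s linearity
and NOT proved; the identification and the VALUE of the named limit NOT proved (the β sub-cell's ∕ NODE O's wall); NOT a proof of `stub_runRemNamedJets13`, `stub_d1AnchoredJets13`, `stub_rates13H` or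
any stub; N17 ∕ N18 ∕ N22 NOT discharged; K2⁷ ∕ K3⁷ OPEN; counts UNMOVED (typed 28∕28 · discharged 5∕27 · A 5∕28).  One finite four-torus programme at fixed `ε = L^{−K}`, Bałaban AS PRINTED;
the YM mass gap (Clay) is NOT proved by any of this — R4 closes the conditional finite-𝕋⁴ rung `BalabanLadder.UV` only; nothing continuum ∕ ℝ⁴ ∕ OS.  No `instance`, no `notation`, no `axiom`.
[I] = [Balaban1987RG1] T. Bałaban, CMP **109** (1987): Thm 2 p. 259, (1.3) p. 260, (1.20)–(1.22) p. 264, §1 pp. 263–264, Thm 3 p. 264, (2.12)–(2.14) p. 268, (5.10) p. 293, p. 298.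
-/

noncomputable section

namespace Summit.QuantumFields.YangMills.BalabanUVNodes.N17K2ResidueOfU3Triple

open Literature.MathematicalPhysics.QuantumFieldTheory.Balaban1983to89
open Literature.MathematicalPhysics.QuantumFieldTheory.Balaban1983to89.FlowStep
open Literature.MathematicalPhysics.QuantumFieldTheory.Balaban1983to89.T4CouplingMatching (ScaleShiftRate HistLipschitz)
open Literature.MathematicalPhysics.QuantumFieldTheory.Balaban1983to89.T4BetaStationary (betaContH_of_histLipschitz)
open Literature.MathematicalPhysics.QuantumFieldTheory.Balaban1983to89.DagBinding (EndpointExistence)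
open Literature.MathematicalPhysics.QuantumFieldTheory.Balaban1983to89.T4Continuum (T4Family)
open Literature.MathematicalPhysics.QuantumFieldTheory.Balaban1983to89.Beta.Drift (OneLoopDrift)
open Summit.QuantumFields.YangMills.Theorems.BalabanUVNodesK2JsOfRecord (StepColourData beta0OfJs)
open Summit.QuantumFields.YangMills.Theorems.BalabanUVNodesK2NamedJetsRemAt (ScaleAnchor)
open Summit.QuantumFields.YangMills.Theorems.BalabanUVNodesK2NamedJetsRunRemAt (RunRemAt SurvCont endpointExistence_of_runRemAt_drift)
open Summit.QuantumFields.YangMills.BalabanUVNodes.N17RunRemAtOfShiftAnchor (survCont_allLevels_of_betaContH)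
open Summit.QuantumFields.YangMills.BalabanUVNodes.N17RunRemAtOfShiftAnchorLevel (runRemAt_of_n17At_scaleAnchor_survContAt)
open Summit.QuantumFields.YangMills.BalabanUVNodes.N17D1OfNamedLimit (exists_oneLoopDrift_iff_tendsto_stepBal_of_n17At_scaleAnchor)
open YMDAG.UVSplit (U3Carriers N17At N18At N22At ReadOutAt)
open YMDAG.N17 (n17At_of_readOutAt u2Inputs_of_readOutAt)
open Filter Topology

/-! ## §1 Generic: history moduli ⟹ survivor continuity at every level -/

/-- **A HISTORY-LIPSCHITZ β-FAMILY HAS RUN-WISE (C) AT EVERY LEVEL `≤ γ`**: `HistLipschitz Λ γ β` (NE9's moduli read out on β, `T4CouplingMatching.HistLipschitz`) ⟹ box (C) on `]0,γ]`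
(`T4BetaStationary.betaContH_of_histLipschitz`) ⟹ DEF-1's `SurvCont β γ₀` for every `0 < γ₀ ≤ γ` (FILE 1 `survCont_allLevels_of_betaContH`). [cite: Balaban1987RG1, §1 pp.263-264 and p.298] -/
theorem survCont_allLevels_of_histLipschitz {β : HBeta} {Λ : ℕ → ℕ → ℝ} {γ : ℝ} (hL : HistLipschitz Λ γ β) :
    ∀ γ₀ : ℝ, 0 < γ₀ → γ₀ ≤ γ → SurvCont β γ₀ :=
  survCont_allLevels_of_betaContH (betaContH_of_histLipschitz hL)

/-! ## §2 At NODE 00's Stage-13 record (`N = 2`): node U3's END-free triple ⟹ N17 ∧ (C); 2ᴮ″'s letter ⟺ the anchor -/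

section Record

variable (F : T4Family) (κ : StepColourData) (θ : Node00.Stage13HParams F 2) (hP : θ.Provisos₁₃SepCoPH F 2)

/-- **NODE U3's TRIPLE ⟹ (C) AT EVERY LEVEL ≤ THE WINDOW**: (D4) ∧ N18 ∧ N22 at a bundle `u` on the datum of record give node U2's input triple (dag-n17-a `u2Inputs_of_readOutAt`), whose
`HistLipschitz` conjunct makes the datum's β history-Lipschitz on the `u.γ`-boxes, hence survivor-continuous at every level `≤ u.γ`.  CONDITIONAL.
[cite: Balaban1987RG1, (1.20)-(1.22) p.264, §1 pp.263-264 and p.298] -/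
theorem survCont_allLevels_of_u3Triple {u : U3Carriers} (hD4 : ReadOutAt (Node00.datumOfRecord₁₃SepCoPH F 2 θ hP) u) (h18 : N18At u) (h22 : N22At u) :
    ∀ γ₀ : ℝ, 0 < γ₀ → γ₀ ≤ u.γ → SurvCont (Node00.datumOfRecord₁₃SepCoPH F 2 θ hP).βfun γ₀ :=
  survCont_allLevels_of_histLipschitz (u2Inputs_of_readOutAt (Node00.datumOfRecord₁₃SepCoPH F 2 θ hP) hD4 h18 h22).2.1

/-- ★★ **NODE U3's TRIPLE + THE ANCHOR ⟹ THE REGISTERED RUN LETTER**: at an admissible proviso'd Stage-13 tuple, (D4) ∧ N18 ∧ N22 at a bundle with window `= θ.γ` and rate letter `0 ≤ u.ρ < 1`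
+ DEF-1's anchor at `θ.cβ • beta0OfJs F κ` ⟹ `RunRemAt F κ θ hP θ.cβ` — N17 from (D4) ∧ N18 (`n17At_of_readOutAt`), (C) at level `θ.γ` from N22's moduli, FILE 2's one-level junction.  CONDITIONAL.
[cite: Balaban1987RG1, (1.20)-(1.22) p.264, (2.12)-(2.14) p.268 and Thm 3 p.264] -/
theorem runRemAt_of_u3Triple_scaleAnchor (hθ : θ.Admissible F 2) {u : U3Carriers} (hγu : u.γ = θ.γ) (hρ0 : 0 ≤ u.ρ) (hρ1 : u.ρ < 1)
    (hD4 : ReadOutAt (Node00.datumOfRecord₁₃SepCoPH F 2 θ hP) u) (h18 : N18At u) (h22 : N22At u)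
    (hA : ScaleAnchor (Node00.datumOfRecord₁₃SepCoPH F 2 θ hP).βfun (fun k => θ.cβ * beta0OfJs F κ k)) :
    RunRemAt F κ θ hP θ.cβ := by
  have hγ : 0 < θ.γ := hθ.toStage12.toStage9.gamma_pos
  have hsc := survCont_allLevels_of_u3Triple F θ hP hD4 h18 h22 u.γ (hγu ▸ hγ) le_rfl
  exact runRemAt_of_n17At_scaleAnchor_survContAt F κ θ hP hθ hγu hρ0 hρ1 (n17At_of_readOutAt _ hD4 h18) hA (hγu ▸ hγ) hsc

/-- ★★★ **GIVEN NODE U3's TRIPLE, THE REGISTERED LETTER `RunRemAt F κ θ hP θ.cβ` IS EXACTLY THE IDENTIFICATION CLAUSE `ScaleAnchor D.βfun (θ.cβ • beta0OfJs F κ)`** — 2ᴮ″'s quantitative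
remainder conjunct is node N17's, its (C) conjunct node N22's, its window clause carries no content.  (→: projection; ←: the previous theorem.)  CONDITIONAL on the triple.
[cite: Balaban1987RG1, (1.20)-(1.22) p.264, (2.12)-(2.14) p.268 and Thm 3 p.264] -/
theorem runRemAt_iff_scaleAnchor_of_u3Triple (hθ : θ.Admissible F 2) {u : U3Carriers} (hγu : u.γ = θ.γ) (hρ0 : 0 ≤ u.ρ) (hρ1 : u.ρ < 1)
    (hD4 : ReadOutAt (Node00.datumOfRecord₁₃SepCoPH F 2 θ hP) u) (h18 : N18At u) (h22 : N22At u) :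
    RunRemAt F κ θ hP θ.cβ ↔ ScaleAnchor (Node00.datumOfRecord₁₃SepCoPH F 2 θ hP).βfun (fun k => θ.cβ * beta0OfJs F κ k) := by
  constructor
  · rintro ⟨-, -, -, -, -, -, hA, -⟩
    exact hA
  · exact runRemAt_of_u3Triple_scaleAnchor F κ θ hP hθ hγu hρ0 hρ1 hD4 h18 h22

/-- **GIVEN NODE U3's TRIPLE AND THE ANCHOR AT κ, 1ᴬ's CONCLUSION ⟺ «THE NAMED NUMBERS TEND TO `stepBal 2 F.L`»** (FILE 3's `exists_oneLoopDrift_iff_tendsto_stepBal_of_n17At_scaleAnchor` with N17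
from (D4) ∧ N18).  CONDITIONAL. [cite: Balaban1987RG1, (1.3) p.260 and (2.12)-(2.14) p.268] -/
theorem exists_oneLoopDrift_iff_tendsto_stepBal_of_u3Triple_scaleAnchor (hθ : θ.Admissible F 2) {u : U3Carriers} (hγu : u.γ = θ.γ) (hρ0 : 0 ≤ u.ρ) (hρ1 : u.ρ < 1)
    (hD4 : ReadOutAt (Node00.datumOfRecord₁₃SepCoPH F 2 θ hP) u) (h18 : N18At u)
    (hA : ScaleAnchor (Node00.datumOfRecord₁₃SepCoPH F 2 θ hP).βfun (fun k => θ.cβ * beta0OfJs F κ k)) :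
    (∃ A : ℝ, OneLoopDrift (B12Normalization.stepBal 2 F.L) A (beta0OfJs F κ)) ↔ Tendsto (beta0OfJs F κ) atTop (𝓝 (B12Normalization.stepBal 2 F.L)) :=
  exists_oneLoopDrift_iff_tendsto_stepBal_of_n17At_scaleAnchor F κ θ hP hθ hγu hρ0 hρ1 (n17At_of_readOutAt _ hD4 h18) hA

end Record

/-! ## §3 Text level (K2⁷ v6's full prefix; `Window13` spelled as the crux decl spells it).  THE END-FREE U3-TRIPLE TEXT:
`∀ F θ hP, guards → Admissible → (B) → Window → ∃ u, u.γ = θ.γ ∧ 0 ≤ u.ρ ∧ u.ρ < 1 ∧ ReadOutAt (datum) u ∧ N18At u ∧ N22At u` -/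

section Texts

/-- The U3-triple text implies the `N17AtRecord13` text (dag-n17-a `n17At_of_readOutAt`; N22 unread). [cite: Balaban1987RG1, (1.20)-(1.22) p.264] -/
theorem n17AtRecord13_of_u3TripleAtRecord13
    (hU : ∀ (F : T4Family) (θ : Node00.Stage13HParams F 2) (hP : θ.Provisos₁₃SepCoPH F 2), (θ.ZhUnity F 2 ∧ θ.SlotsNondegenerate₁₃ F 2) → θ.Admissible F 2 →
      B16.EndStatementBPrinted (Node00.datumOfRecord₁₃SepCoPH F 2 θ hP).C →
      (∃ γ₁ : ℝ, 0 < γ₁ ∧ ∀ γ : ℝ, 0 < γ → γ ≤ γ₁ → ∃ P : B12.RunParams, 1 ≤ P.K ∧ ((Node00.datumOfRecord₁₃SepCoPH F 2 θ hP).C P).flow.InInterval γ P.K) →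
      ∃ u : U3Carriers, u.γ = θ.γ ∧ 0 ≤ u.ρ ∧ u.ρ < 1 ∧ ReadOutAt (Node00.datumOfRecord₁₃SepCoPH F 2 θ hP) u ∧ N18At u ∧ N22At u) :
    ∀ (F : T4Family) (θ : Node00.Stage13HParams F 2) (hP : θ.Provisos₁₃SepCoPH F 2), (θ.ZhUnity F 2 ∧ θ.SlotsNondegenerate₁₃ F 2) → θ.Admissible F 2 →
      B16.EndStatementBPrinted (Node00.datumOfRecord₁₃SepCoPH F 2 θ hP).C →
      (∃ γ₁ : ℝ, 0 < γ₁ ∧ ∀ γ : ℝ, 0 < γ → γ ≤ γ₁ → ∃ P : B12.RunParams, 1 ≤ P.K ∧ ((Node00.datumOfRecord₁₃SepCoPH F 2 θ hP).C P).flow.InInterval γ P.K) →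
      ∃ u : U3Carriers, u.γ = θ.γ ∧ 0 ≤ u.ρ ∧ u.ρ < 1 ∧ N17At (Node00.datumOfRecord₁₃SepCoPH F 2 θ hP) u := by
  intro F θ hP hG hθ hB hwin
  obtain ⟨u, hγu, hρ0, hρ1, hD4, h18, -⟩ := hU F θ hP hG hθ hB hwin
  exact ⟨u, hγu, hρ0, hρ1, n17At_of_readOutAt _ hD4 h18⟩

/-- ★★★ **GIVEN THE U3-TRIPLE TEXT, THE REGISTERED 2ᴮ″ TEXT `RunRemAtSomeJets` IS EQUIVALENT TO THE ANCHOR TEXT «∃ κ, ScaleAnchor (datum).βfun (θ.cβ • beta0OfJs F κ)»** (refuter CRIT-2 ROUND 2e's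
BN-F-immune `AnchorSomeJets13`, with v6's prefix) — modulo node U3's END-free rows, K2⁷'s XL stub 2ᴮ″ is the identification clause alone.  CONDITIONAL; NOT a proof of `stub_runRemNamedJets13`.
[cite: Balaban1987RG1, (1.20)-(1.22) p.264, (2.12)-(2.14) p.268 and Thm 3 p.264] -/
theorem runRemAtSomeJets_iff_anchorSomeJets_of_u3TripleAtRecord13
    (hU : ∀ (F : T4Family) (θ : Node00.Stage13HParams F 2) (hP : θ.Provisos₁₃SepCoPH F 2), (θ.ZhUnity F 2 ∧ θ.SlotsNondegenerate₁₃ F 2) → θ.Admissible F 2 →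
      B16.EndStatementBPrinted (Node00.datumOfRecord₁₃SepCoPH F 2 θ hP).C →
      (∃ γ₁ : ℝ, 0 < γ₁ ∧ ∀ γ : ℝ, 0 < γ → γ ≤ γ₁ → ∃ P : B12.RunParams, 1 ≤ P.K ∧ ((Node00.datumOfRecord₁₃SepCoPH F 2 θ hP).C P).flow.InInterval γ P.K) →
      ∃ u : U3Carriers, u.γ = θ.γ ∧ 0 ≤ u.ρ ∧ u.ρ < 1 ∧ ReadOutAt (Node00.datumOfRecord₁₃SepCoPH F 2 θ hP) u ∧ N18At u ∧ N22At u) :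
    (∀ (F : T4Family) (θ : Node00.Stage13HParams F 2) (hP : θ.Provisos₁₃SepCoPH F 2), (θ.ZhUnity F 2 ∧ θ.SlotsNondegenerate₁₃ F 2) → θ.Admissible F 2 →
      B16.EndStatementBPrinted (Node00.datumOfRecord₁₃SepCoPH F 2 θ hP).C →
      (∃ γ₁ : ℝ, 0 < γ₁ ∧ ∀ γ : ℝ, 0 < γ → γ ≤ γ₁ → ∃ P : B12.RunParams, 1 ≤ P.K ∧ ((Node00.datumOfRecord₁₃SepCoPH F 2 θ hP).C P).flow.InInterval γ P.K) →
      ∃ κ : StepColourData, RunRemAt F κ θ hP θ.cβ) ↔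
    (∀ (F : T4Family) (θ : Node00.Stage13HParams F 2) (hP : θ.Provisos₁₃SepCoPH F 2), (θ.ZhUnity F 2 ∧ θ.SlotsNondegenerate₁₃ F 2) → θ.Admissible F 2 →
      B16.EndStatementBPrinted (Node00.datumOfRecord₁₃SepCoPH F 2 θ hP).C →
      (∃ γ₁ : ℝ, 0 < γ₁ ∧ ∀ γ : ℝ, 0 < γ → γ ≤ γ₁ → ∃ P : B12.RunParams, 1 ≤ P.K ∧ ((Node00.datumOfRecord₁₃SepCoPH F 2 θ hP).C P).flow.InInterval γ P.K) →
      ∃ κ : StepColourData, ScaleAnchor (Node00.datumOfRecord₁₃SepCoPH F 2 θ hP).βfun (fun k => θ.cβ * beta0OfJs F κ k)) := by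
  constructor
  · intro h F θ hP hG hθ hB hwin
    obtain ⟨κ, -, -, -, -, -, -, hA, -⟩ := h F θ hP hG hθ hB hwin
    exact ⟨κ, hA⟩
  · intro h F θ hP hG hθ hB hwin
    obtain ⟨u, hγu, hρ0, hρ1, hD4, h18, h22⟩ := hU F θ hP hG hθ hB hwin
    obtain ⟨κ, hA⟩ := h F θ hP hG hθ hB hwin
    exact ⟨κ, runRemAt_of_u3Triple_scaleAnchor F κ θ hP hθ hγu hρ0 hρ1 hD4 h18 h22 hA⟩

/-- ★★★ **THE K2⁷ CRUX DECL BY NAME FROM THE U3-TRIPLE TEXT + ONE LOCATED TEXT «at every tuple SOME colour datum κ ANCHORS the record's β and its named one-loop numbers tend to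
`stepBal 2 F.L`»** — per tuple: the run letter from §2, the drift from the limit (§2 iff ←), DEF-1's `endpointExistence_of_runRemAt_drift`.  THE LOCATED RESIDUE OF K2⁷ MODULO NODE U3's
END-FREE ROWS: identification + the VALUE of the named limit.  CONDITIONAL on both displayed hypotheses; K2⁷ NOT closed; nothing of Bałaban asserted.
[cite: Balaban1987RG1, Thm 2 p.259 (first sentence), (1.3) p.260, (1.20)-(1.22) p.264 and (2.12)-(2.14) p.268] -/
theorem EndpointGivenBR13SepCoPH_of_u3TripleAtRecord13_anchorLimit
    (hU : ∀ (F : T4Family) (θ : Node00.Stage13HParams F 2) (hP : θ.Provisos₁₃SepCoPH F 2), (θ.ZhUnity F 2 ∧ θ.SlotsNondegenerate₁₃ F 2) → θ.Admissible F 2 →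
      B16.EndStatementBPrinted (Node00.datumOfRecord₁₃SepCoPH F 2 θ hP).C →
      (∃ γ₁ : ℝ, 0 < γ₁ ∧ ∀ γ : ℝ, 0 < γ → γ ≤ γ₁ → ∃ P : B12.RunParams, 1 ≤ P.K ∧ ((Node00.datumOfRecord₁₃SepCoPH F 2 θ hP).C P).flow.InInterval γ P.K) →
      ∃ u : U3Carriers, u.γ = θ.γ ∧ 0 ≤ u.ρ ∧ u.ρ < 1 ∧ ReadOutAt (Node00.datumOfRecord₁₃SepCoPH F 2 θ hP) u ∧ N18At u ∧ N22At u)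
    (hAL : ∀ (F : T4Family) (θ : Node00.Stage13HParams F 2) (hP : θ.Provisos₁₃SepCoPH F 2), (θ.ZhUnity F 2 ∧ θ.SlotsNondegenerate₁₃ F 2) → θ.Admissible F 2 →
      B16.EndStatementBPrinted (Node00.datumOfRecord₁₃SepCoPH F 2 θ hP).C →
      (∃ γ₁ : ℝ, 0 < γ₁ ∧ ∀ γ : ℝ, 0 < γ → γ ≤ γ₁ → ∃ P : B12.RunParams, 1 ≤ P.K ∧ ((Node00.datumOfRecord₁₃SepCoPH F 2 θ hP).C P).flow.InInterval γ P.K) →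
      ∃ κ : StepColourData, ScaleAnchor (Node00.datumOfRecord₁₃SepCoPH F 2 θ hP).βfun (fun k => θ.cβ * beta0OfJs F κ k) ∧
        Tendsto (beta0OfJs F κ) atTop (𝓝 (B12Normalization.stepBal 2 F.L))) :
    Summit.QuantumFields.YangMills.Theses.BalabanUVNodes.EndpointGivenBR13SepCoPH := by
  intro F θ hP hG hθ hB hwin
  obtain ⟨u, hγu, hρ0, hρ1, hD4, h18, h22⟩ := hU F θ hP hG hθ hB hwin
  obtain ⟨κ, hA, hlim⟩ := hAL F θ hP hG hθ hB hwin
  have hRun : RunRemAt F κ θ hP θ.cβ := runRemAt_of_u3Triple_scaleAnchor F κ θ hP hθ hγu hρ0 hρ1 hD4 h18 h22 hA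
  obtain ⟨A, hdrift⟩ := (exists_oneLoopDrift_iff_tendsto_stepBal_of_u3Triple_scaleAnchor F κ θ hP hθ hγu hρ0 hρ1 hD4 h18 hA).2 hlim
  exact endpointExistence_of_runRemAt_drift F κ θ hP hRun hdrift

end Texts

end Summit.QuantumFields.YangMills.BalabanUVNodes.N17K2ResidueOfU3Triple

end
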